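import Mathlib
import HarnessLib
import Literature.MathematicalPhysics.KineticTheory.HardSphereEuler
import Literature.MathematicalPhysics.KineticTheory.BackwardCluster
import Summits.AtomisticToContinuum.HydrodynamicLimit.Theses.RelayRaceLocality

/-!
# Stub `stub_reduction` of the line `Sketch` (log-window-tagged-tail) for the crux
`RelayRaceLocality.GibbsLightCone` (stmt-AtomisticToContinuum-12501)

Registered stub of the lead prover's skeleton (`Cruxes/GibbsLightCone/Lines/Sketch.lean`): the
LOG-WINDOW UNION BOUND. Window composition + cluster shift + Gibbs invariance + null off-good +
window bookkeeping + the tagged window span tail imply the crux `GibbsLightCone`, with cone speed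
`c := max λ 1 · √θ`.

* `t = 0`: on the good set `Φ_0 = id` and the backward cluster over the empty window `(0, 0]` is
  empty, so the crux event forces `δ < dist(x_i, x_i) = 0`; the event lies in the complement of
  the good set, which is Gibbs-null.
* `t > 0`: write `t = n_N · W_N`, `W_N = M_N τ_N` (bookkeeping). On the good set the crux event
  with threshold `c t + δ > n_N · (λ M_N ℓ_N)` forces (window composition, contrapositive) a window
  `a < n_N` and a pair `(q, r)` violating the per-window bound, i.e. `z ∈ (Φ_{a W})⁻¹' ⋃_q F_q`
  (cluster shift + `flow_add`), where `F_q` is the tail event of the tagged particle `q`; by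
  invariance (`Measure.le_map_apply`) and subadditivity the probability is
  `≤ n_N (N+1) C e^{-c M_N} → 0`.

No measurability of the events is needed (outer-measure monotonicity and subadditivity).
-/

namespace Summit.AtomisticToContinuum.HydrodynamicLimit.Theorems.LogWindowTaggedTail

open Literature.MathematicalPhysics.KineticTheory Literature.Analysis.FluidPDE MeasureTheory Filter Set

open scoped ENNReal

/-- Cone-speed arithmetic: with `t = n · M · ℓ / √θ`, `M ≥ 1`, `ℓ ≥ 0`, the accumulated per-window
span bound `n · (λ M ℓ)` is at most `(max λ 1 · √θ) · t`. [folklore] -/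
theorem reduction_speed {lam θ M ℓ t : ℝ} {n : ℕ} (hθ : 0 < θ) (hM : 1 ≤ M) (hℓ : 0 ≤ ℓ)
    (ht : (n : ℝ) * (M * (ℓ / Real.sqrt θ)) = t) :
    (n : ℝ) * (lam * M * ℓ) ≤ max lam 1 * Real.sqrt θ * t := by
  subst ht
  have hsq : 0 < Real.sqrt θ := Real.sqrt_pos.2 hθ
  have h1 : max lam 1 * Real.sqrt θ * ((n : ℝ) * (M * (ℓ / Real.sqrt θ))) =
      max lam 1 * ((n : ℝ) * (M * ℓ)) := by
    rw [show max lam 1 * Real.sqrt θ * ((n : ℝ) * (M * (ℓ / Real.sqrt θ))) =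
        max lam 1 * ((n : ℝ) * (M * ℓ)) * (Real.sqrt θ / Real.sqrt θ) by ring,
      div_self hsq.ne', mul_one]
  rw [h1, show (n : ℝ) * (lam * M * ℓ) = lam * ((n : ℝ) * (M * ℓ)) by ring]
  exact mul_le_mul_of_nonneg_right (le_max_left _ _)
    (mul_nonneg (Nat.cast_nonneg _) (mul_nonneg (by linarith) hℓ))

/-- `ofReal ((K : ℝ) * n * X) = n * (K * ofReal X)` in `ℝ≥0∞`. [folklore] -/
theorem reduction_ofReal_bound (K n : ℕ) (X : ℝ) :
    ENNReal.ofReal ((K : ℝ) * (n : ℝ) * X) = (n : ℝ≥0∞) * ((K : ℝ≥0∞) * ENNReal.ofReal X) := by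
  rw [ENNReal.ofReal_mul (by positivity), ENNReal.ofReal_mul (by positivity),
    ENNReal.ofReal_natCast, ENNReal.ofReal_natCast]
  ring

/-- A finite union of `K` events each of measure `≤ B` has measure `≤ K · B`. [folklore] -/
theorem reduction_iUnion_le {α : Type*} [MeasurableSpace α] (P : Measure α) {K : ℕ}
    (F : Fin K → Set α) {B : ℝ≥0∞} (hB : ∀ q, P (F q) ≤ B) :
    P (⋃ q, F q) ≤ (K : ℝ≥0∞) * B := by
  calc P (⋃ q, F q) ≤ ∑ q, P (F q) := measure_iUnion_fintype_le P F
    _ ≤ ∑ _q : Fin K, B := Finset.sum_le_sum fun q _ => hB q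
    _ = (K : ℝ≥0∞) * B := by
      rw [Finset.sum_const, Finset.card_univ, Fintype.card_fin, nsmul_eq_mul]

/-- KEY POINTWISE INCLUSION (window composition, contrapositive, then cluster shift and
`flow_add`): on the good set, the crux event with `t = n W` and threshold `c t + δ > n L` lies in
the union over the windows `a < n` of the preimages under `Φ_{a W}` of the union over the tagged
particles `q` of the one-window tail events. [folklore] -/
theorem reduction_cover
    (hWC : ∀ (N : ℕ) (ε : ℝ) (Φ : HardSphereFlow (Torus.geometry (Fin 3)) ε N)
      (z : Config N (Fin 3) T3),
      z ∈ Φ.good → ∀ (W L : ℝ), 0 < W → ∀ n : ℕ,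
        (∀ a : ℕ, a < n → ∀ q r : Fin N,
            (r = q ∨ r ∈ Φ.backwardCluster q (a * W) ((a + 1) * W) z) →
            Torus.euclidDist ((Φ.flow (a * W) z) r).1 ((Φ.flow ((a + 1) * W) z) q).1 ≤ L) →
        ∀ i j : Fin N, (j = i ∨ j ∈ Φ.backwardCluster i 0 (n * W) z) →
          Torus.euclidDist (z j).1 ((Φ.flow (n * W) z) i).1 ≤ n * L)
    (hShift : ∀ (N : ℕ) (ε : ℝ) (Φ : HardSphereFlow (Torus.geometry (Fin 3)) ε N)
      (z : Config N (Fin 3) T3),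
      z ∈ Φ.good → ∀ (i : Fin N) (s t : ℝ),
        Φ.backwardCluster i s t z = Φ.backwardCluster i 0 (t - s) (Φ.flow s z))
    {K : ℕ} {ε : ℝ} (Ψ : HardSphereFlow (Torus.geometry (Fin 3)) ε K)
    {W L cS t δ : ℝ} (hW : 0 < W) {n : ℕ} (hnW : (n : ℝ) * W = t) (hL : (n : ℝ) * L ≤ cS * t)
    (hδ : 0 < δ) :
    {z | ∃ i j : Fin K, (j = i ∨ j ∈ Ψ.backwardCluster i 0 t z) ∧
        cS * t + δ < Torus.euclidDist (z j).1 ((Ψ.flow t z) i).1} ∩ Ψ.good ⊆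
      ⋃ a ∈ Finset.range n, (Ψ.flow (a * W)) ⁻¹'
        (⋃ q : Fin K, {w | ∃ r : Fin K, (r = q ∨ r ∈ Ψ.backwardCluster q 0 W w) ∧
          L < Torus.euclidDist (w r).1 ((Ψ.flow W w) q).1}) := by
  rintro z ⟨⟨i, j, hij, hdist⟩, hz⟩
  subst hnW
  by_contra hcon
  have hwin : ∀ a : ℕ, a < n → ∀ q r : Fin K,
      (r = q ∨ r ∈ Ψ.backwardCluster q (a * W) ((a + 1) * W) z) →
      Torus.euclidDist ((Ψ.flow (a * W) z) r).1 ((Ψ.flow ((a + 1) * W) z) q).1 ≤ L := by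
    intro a ha q r hr
    by_contra hlt
    have hlt' := not_le.1 hlt
    have hr' : r = q ∨ r ∈ Ψ.backwardCluster q 0 W (Ψ.flow (a * W) z) := by
      rw [hShift K ε Ψ z hz q (a * W) ((a + 1) * W),
        show ((a : ℝ) + 1) * W - a * W = W by ring] at hr
      exact hr
    have hflow : Ψ.flow (((a : ℝ) + 1) * W) z = Ψ.flow W (Ψ.flow (a * W) z) := by
      rw [show ((a : ℝ) + 1) * W = W + a * W by ring]
      exact Ψ.flow_add W (a * W) z hz
    rw [hflow] at hlt'
    apply hcon
    simp only [Set.mem_iUnion, Set.mem_preimage, Set.mem_setOf_eq, exists_prop, Finset.mem_range]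
    exact ⟨a, ha, q, r, hr', hlt'⟩
  have hle := hWC K ε Ψ z hz W L hW n hwin i j hij
  linarith

/-- THE UNION BOUND: if the law `P` is `Φ_s`-invariant for every `s` and does not charge the
complement of the good set, and the event `S` is covered on the good set by `n` preimages
`(Φ_{a W})⁻¹' U`, then `P S ≤ n · P U` (`Measure.le_map_apply`, no measurability needed).
[folklore] -/
theorem reduction_union_bound {K : ℕ} {ε : ℝ} (Ψ : HardSphereFlow (Torus.geometry (Fin 3)) ε K)
    (P : Measure (Config K (Fin 3) T3)) (hPinv : ∀ s : ℝ, P.map (Ψ.flow s) = P)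
    (hPnull : P Ψ.goodᶜ = 0) {S U : Set (Config K (Fin 3) T3)} {W : ℝ} {n : ℕ} {B : ℝ≥0∞}
    (hcover : S ∩ Ψ.good ⊆ ⋃ a ∈ Finset.range n, (Ψ.flow (a * W)) ⁻¹' U) (hU : P U ≤ B) :
    P S ≤ (n : ℝ≥0∞) * B := by
  have hstep : ∀ a : ℕ, P ((Ψ.flow (a * W)) ⁻¹' U) ≤ B := fun a =>
    calc P ((Ψ.flow (a * W)) ⁻¹' U) ≤ P.map (Ψ.flow (a * W)) U :=
          Measure.le_map_apply (Ψ.measurable_flow _).aemeasurable U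
      _ = P U := by rw [hPinv]
      _ ≤ B := hU
  calc P S = P (S ∩ Ψ.good) := (measure_inter_conull hPnull).symm
    _ ≤ P (⋃ a ∈ Finset.range n, (Ψ.flow (a * W)) ⁻¹' U) := measure_mono hcover
    _ ≤ ∑ a ∈ Finset.range n, P ((Ψ.flow (a * W)) ⁻¹' U) := measure_biUnion_finset_le _ _
    _ ≤ ∑ _a ∈ Finset.range n, B := Finset.sum_le_sum fun a _ => hstep a
    _ = (n : ℝ≥0∞) * B := by rw [Finset.sum_const, Finset.card_range, nsmul_eq_mul]

/-- THE REDUCTION (log-window union bound; registered stub `stub_reduction` of the line `Sketch`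
for the crux `GibbsLightCone`, stmt-AtomisticToContinuum-12501): window composition + cluster
shift + invariance + null off-good + window bookkeeping + the tagged window span tail imply the
crux, with cone speed `c := max λ 1 · √θ`: for `t > 0` write `t = n_N · W_N`, `W_N = M_N τ_N`; on
the good set the crux event with threshold `c t + δ > n_N · (λ M_N ℓ_N)` forces (window
composition, contrapositive) a window `a < n_N` and a pair `(q, r)` violating the per-window
bound, i.e. `z ∈ (Φ_{a W})⁻¹' ⋃_q F_q` (cluster shift + `flow_add`), where `F_q` is the C⁺ event
of `q`; by invariance (`Measure.le_map_apply`) and subadditivity the probability is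
`≤ n_N (N+1) C e^{-c M_N} → 0`; the `t = 0` slice is null (`flow_zero`, `backwardCluster_of_le`,
`euclidDist_self`). [folklore] -/
theorem stub_reduction :
    (∀ (N : ℕ) (ε : ℝ) (Φ : HardSphereFlow (Torus.geometry (Fin 3)) ε N) (z : Config N (Fin 3) T3),
      z ∈ Φ.good → ∀ (W L : ℝ), 0 < W → ∀ n : ℕ,
        (∀ a : ℕ, a < n → ∀ q r : Fin N,
            (r = q ∨ r ∈ Φ.backwardCluster q (a * W) ((a + 1) * W) z) →
            Torus.euclidDist ((Φ.flow (a * W) z) r).1 ((Φ.flow ((a + 1) * W) z) q).1 ≤ L) →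
        ∀ i j : Fin N, (j = i ∨ j ∈ Φ.backwardCluster i 0 (n * W) z) →
          Torus.euclidDist (z j).1 ((Φ.flow (n * W) z) i).1 ≤ n * L) →
    (∀ (N : ℕ) (ε : ℝ) (Φ : HardSphereFlow (Torus.geometry (Fin 3)) ε N) (z : Config N (Fin 3) T3),
      z ∈ Φ.good → ∀ (i : Fin N) (s t : ℝ),
        Φ.backwardCluster i s t z = Φ.backwardCluster i 0 (t - s) (Φ.flow s z)) →
    (∀ (σ a θ : ℝ) (N : ℕ)
      (Φ : HardSphereFlow (Torus.geometry (Fin 3)) (hsDiameter σ N) (N + 1)) (s : ℝ),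
      (localGibbsLaw σ (fun _ => a) (fun _ => 0) (fun _ => θ) N Φ).map (Φ.flow s) =
        localGibbsLaw σ (fun _ => a) (fun _ => 0) (fun _ => θ) N Φ) →
    (∀ (σ a θ : ℝ) (N : ℕ)
      (Φ : HardSphereFlow (Torus.geometry (Fin 3)) (hsDiameter σ N) (N + 1)),
      localGibbsLaw σ (fun _ => a) (fun _ => 0) (fun _ => θ) N Φ Φ.goodᶜ = 0) →
    (∀ (t θ σ c C : ℝ), 0 < t → 0 < θ → 0 < σ → 0 < c →
      ∃ (n : ℕ → ℕ) (M : ℕ → ℝ),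
        (∀ N, 0 < n N) ∧
        (∀ N, (n N : ℝ) * (M N * (((N + 1 : ℕ) : ℝ) ^ (-(1 / 3 : ℝ)) / σ ^ 2 / Real.sqrt θ)) = t) ∧
        (∀ᶠ N in atTop, 1 ≤ M N) ∧
        Tendsto (fun N => ((N + 1 : ℕ) : ℝ) * (n N : ℝ) * (C * Real.exp (-c * M N))) atTop
          (nhds 0)) →
    (∀ a θ : ℝ, 0 < a → 0 < θ → ∃ σ₀ : ℝ, 0 < σ₀ ∧ ∃ lam c C : ℝ, 0 < c ∧
      ∀ σ : ℝ, 0 < σ → σ < σ₀ →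
      ∀ Φ : (N : ℕ) → HardSphereFlow (Torus.geometry (Fin 3)) (hsDiameter σ N) (N + 1),
      ∀ᶠ N in atTop, ∀ p : Fin (N + 1), ∀ M : ℝ, 1 ≤ M →
        localGibbsLaw σ (fun _ => a) (fun _ => 0) (fun _ => θ) N (Φ N)
          {z | ∃ r : Fin (N + 1),
              (r = p ∨ r ∈ (Φ N).backwardCluster p 0
                (M * (((N + 1 : ℕ) : ℝ) ^ (-(1 / 3 : ℝ)) / σ ^ 2 / Real.sqrt θ)) z) ∧
              lam * M * (((N + 1 : ℕ) : ℝ) ^ (-(1 / 3 : ℝ)) / σ ^ 2) <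
                Torus.euclidDist (z r).1
                  (((Φ N).flow (M * (((N + 1 : ℕ) : ℝ) ^ (-(1 / 3 : ℝ)) / σ ^ 2 / Real.sqrt θ)) z)
                    p).1}
          ≤ ENNReal.ofReal (C * Real.exp (-c * M))) →
    Summit.AtomisticToContinuum.HydrodynamicLimit.Theses.RelayRaceLocality.GibbsLightCone := by
  intro hWC hShift hInv hNull hAsy hTail
  unfold Summit.AtomisticToContinuum.HydrodynamicLimit.Theses.RelayRaceLocality.GibbsLightCone
  intro a θ ha hθ
  obtain ⟨σ₀, hσ₀, lam, c, C, hc, H⟩ := hTail a θ ha hθ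
  have hsq : 0 < Real.sqrt θ := Real.sqrt_pos.2 hθ
  refine ⟨σ₀, hσ₀, max lam 1 * Real.sqrt θ, mul_pos (lt_max_of_lt_right one_pos) hsq, ?_⟩
  intro σ hσ hσσ₀ Φ t ht δ hδ
  rcases ht.eq_or_lt with rfl | ht'
  · -- the `t = 0` slice is Gibbs-null
    refine tendsto_nhds_of_eventually_eq (Eventually.of_forall fun N => ?_)
    refine le_antisymm ((measure_mono ?_).trans (hNull σ a θ N (Φ N)).le) bot_le
    rintro z ⟨i, j, hij, hdist⟩ hz
    rcases hij with rfl | hmem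
    · rw [(Φ N).flow_zero z hz, Torus.euclidDist_self] at hdist
      linarith
    · rw [(Φ N).backwardCluster_apply hz, backwardCluster_of_le (le_refl (0 : ℝ))] at hmem
      exact Finset.notMem_empty _ hmem
  · -- `t > 0`: log-window union bound
    obtain ⟨n, M, -, hprod, hM1, hlim⟩ := hAsy t θ σ c C ht' hθ hσ hc
    have hH := H σ hσ hσσ₀ Φ
    have hupper : Tendsto (fun N => ((n N : ℕ) : ℝ≥0∞) *
        (((N + 1 : ℕ) : ℝ≥0∞) * ENNReal.ofReal (C * Real.exp (-c * M N)))) atTop (nhds 0) := by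
      have h := ENNReal.tendsto_ofReal hlim
      rw [ENNReal.ofReal_zero] at h
      exact h.congr' (Eventually.of_forall fun N => reduction_ofReal_bound (N + 1) (n N) _)
    refine tendsto_of_tendsto_of_tendsto_of_le_of_le' tendsto_const_nhds hupper
      (Eventually.of_forall fun _ => bot_le) ?_
    filter_upwards [hM1, hH] with N hMN hHN
    have hℓ : 0 < ((N + 1 : ℕ) : ℝ) ^ (-(1 / 3 : ℝ)) / σ ^ 2 := by positivity
    have hW : 0 < M N * (((N + 1 : ℕ) : ℝ) ^ (-(1 / 3 : ℝ)) / σ ^ 2 / Real.sqrt θ) :=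
      mul_pos (by linarith) (div_pos hℓ hsq)
    have hL : (n N : ℝ) * (lam * M N * (((N + 1 : ℕ) : ℝ) ^ (-(1 / 3 : ℝ)) / σ ^ 2)) ≤
        max lam 1 * Real.sqrt θ * t :=
      reduction_speed hθ hMN hℓ.le (hprod N)
    exact reduction_union_bound (Φ N) _ (hInv σ a θ N (Φ N)) (hNull σ a θ N (Φ N))
      (reduction_cover hWC hShift (Φ N) hW (hprod N) hL hδ)
      (reduction_iUnion_le _ _ fun q => hHN q (M N) hMN)

end Summit.AtomisticToContinuum.HydrodynamicLimit.Theorems.LogWindowTaggedTail
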